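import Summits.ValiantsHypothesis.ValiantsHypothesis.Theorems.KPlusLogSqLawTropicalGradedWalkDomXGlue1
import Summits.ValiantsHypothesis.ValiantsHypothesis.Theorems.KPlusLogSqLawTropicalGradedWalkDomTGlue1
import Summits.ValiantsHypothesis.ValiantsHypothesis.Theorems.KPlusLogSqLawTropicalShiftThreeChain

/-!
# Route «KPlusLogSqLaw» — GRW-lite (all-`m` `K = 4` family): term signs along the chain

HONEST FRAMING.  Helper file of the chain `--supports` the crux `Summit.ValiantsHypothesis.ValiantsHypothesis.Theses.KPlusLogSqLaw.TropicalB`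
(item `stmt-ValiantsHypothesis-19771`, route `KPlusLogSqLaw`; cell `pub-symmetroid`, seat val-sym-trop-p3 g15), on top of
`…TropicalGradedWalkDefs.lean` and the interface lemmas of `…DomDGlue1` / `…DomTGlue1` / `…DomXGlue1`.  Census-side (lower bound)
construction for `TropRootLawAt (n+1) 4`; nothing here bears on `TropicalB` in its window, `WeakLifting`, `MatrixDescartes` or `VP ≠ VNP`.

CONTENT.  The Leibniz terms of consecutive states of the GRW-lite chain have OPPOSITE signs (`termSign` of
`MatrixDescartesFalseOfTropicalMonster.lean`).  Inside a phase `w < m` two consecutive terms differ in at most two columns, so the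
product of their signs is computed from those columns (`Finset.prod_eq_single` / `Finset.prod_eq_mul`; every present incidence has
sign `±1`, `ee_mul_self`; the permutation signs square to `1`, `ShiftThree.sign_mul_self`): `D(w,u,0) → X(w,u,1) → D(w,u+1,0)` (rows of the columns `u−1`, `u` exchanged and back), `X(w,w−1,1) → T(w,w,0)`,
`T(w,w,t) → T(w,w,t+1)` (one class `2 → 3`), and `D(w,0,0) → D(w,2,0)` / `D(w,0,0) → T(w,w,0)` (column `0` flips).  The PHASE
BOUNDARY `T(w,w,w) → D(w+1,0,0)` is in the companion file `…GradedWalkSignsBoundary.lean`; the chain assembly in `…GradedWalkChain.lean`.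
-/

set_option linter.dupNamespace false
set_option autoImplicit false
-- the `Fin.val_mk` clean-up before `omega` is uniform; where projection reduction already fired it is unused
set_option linter.unusedSimpArgs false

namespace Summit.ValiantsHypothesis.ValiantsHypothesis.Theorems.LacunarySymmetroidMatrixDescartes.TropicalCensus

namespace GradedWalk

open Summit.ValiantsHypothesis.ValiantsHypothesis.Theorems.MatrixDescartes.Negative

variable (n : ℕ)

/-! ### signs are `0, ±1` -/

/-- the design's signs lie in `{−1, 0, 1}` (stated as `|ε| < 2`). -/
theorem ee_natAbs_lt_two (a b : Fin (n + 1)) (l : Fin 4) : (ee n a b l).natAbs < 2 := by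
  unfold ee zsign
  split_ifs <;> simp [Int.natAbs_pow]

/-- an integer of absolute value `≤ 1` which is non-zero squares to `1`. -/
theorem int_mul_self_eq_one {x : ℤ} (h0 : x ≠ 0) (h1 : x.natAbs ≤ 1) : x * x = 1 := by
  have h2 : x.natAbs = 1 := by
    have := Int.natAbs_pos.mpr h0
    omega
  rcases Int.natAbs_eq_iff.mp h2 with h | h <;> rw [h] <;> norm_num

/-- a present incidence has sign `±1`. -/
theorem ee_mul_self {a b : Fin (n + 1)} {l : Fin 4} (h : ee n a b l ≠ 0) : ee n a b l * ee n a b l = 1 :=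
  int_mul_self_eq_one h (by have := ee_natAbs_lt_two n a b l; omega)

/-! ### explicit sign values -/

/-- lower cell, class `1`. -/
theorem ee_low_one {a b : Fin (n + 1)} (h : (b : ℕ) < (a : ℕ)) : ee n a b 1 = (-1) ^ ((a : ℕ) * (b : ℕ)) := by
  unfold ee; rw [if_pos h]; simp
/-- lower cell, class `2`. -/
theorem ee_low_two {a b : Fin (n + 1)} (h : (b : ℕ) < (a : ℕ)) :
    ee n a b 2 = (-1) ^ ((a : ℕ) * (b : ℕ)) * (if (b : ℕ) = 0 then -1 else 1) := by
  unfold ee; rw [if_pos h]; simp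
/-- lower cell, class `3`. -/
theorem ee_low_three {a b : Fin (n + 1)} (h : (b : ℕ) < (a : ℕ)) :
    ee n a b 3 = -((-1) ^ ((a : ℕ) * (b : ℕ)) * (if (b : ℕ) = 0 then -1 else 1)) := by
  unfold ee; rw [if_pos h]; simp
/-- upper cell, class `0`. -/
theorem ee_up_zero {a b : Fin (n + 1)} (h : (a : ℕ) < (b : ℕ)) :
    ee n a b 0 = if (a : ℕ) = 0 then zsign n b else 1 := by
  unfold ee; rw [if_neg (by omega), if_neg (by omega)]; simp

/-- diagonal cell, class `1`. -/
theorem ee_diag_one {a b : Fin (n + 1)} (h : (a : ℕ) = (b : ℕ)) : ee n a b 1 = (-1) ^ (b : ℕ) := by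
  unfold ee; rw [if_neg (by omega), if_pos h]; simp

/-- `(−1)^{i²} = (−1)^i`. -/
theorem neg_one_pow_mul_self' (i : ℕ) : (-1 : ℤ) ^ (i * i) = (-1) ^ i := by
  rcases Nat.even_or_odd i with ⟨k, hk⟩ | ⟨k, hk⟩
  · subst hk
    rw [Even.neg_one_pow ⟨(k + k) * k, by ring⟩, Even.neg_one_pow ⟨k, rfl⟩]
  · subst hk
    rw [Odd.neg_one_pow ⟨2 * k * k + 2 * k, by ring⟩, Odd.neg_one_pow ⟨k, rfl⟩]

/-! ### the product of two term signs, column by column -/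

/-- the product of two term signs is the product of the permutation signs times the column-wise products. -/
theorem termSign_mul_termSign (σ σ' : Equiv.Perm (Fin (n + 1))) (μ μ' : Fin (n + 1) → Fin 4) :
    termSign (ee n) (σ, μ) * termSign (ee n) (σ', μ') =
      (((Equiv.Perm.sign σ : ℤˣ) : ℤ) * ((Equiv.Perm.sign σ' : ℤˣ) : ℤ)) * ∏ b, (ee n (σ b) b (μ b) * ee n (σ' b) b (μ' b)) := by
  simp only [termSign]
  rw [Finset.prod_mul_distrib]; ring

/-- the parity bookkeeping of the two exchanged columns: `(−1)^{R(u−1)} (−1)^{(R+1)(u−1)} (−1)^{(R+1)u} (−1)^{Ru} = −1`. -/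
theorem exchange_parity (R u : ℕ) (hu : 1 ≤ u) :
    (-1 : ℤ) ^ (R * (u - 1)) * (-1) ^ ((R + 1) * (u - 1)) * ((-1) ^ ((R + 1) * u) * (-1) ^ (R * u)) = -1 := by
  obtain ⟨v, rfl⟩ : ∃ v, u = v + 1 := ⟨u - 1, by omega⟩
  rw [Nat.add_sub_cancel, ← pow_add, ← pow_add, ← pow_add]
  have h : R * v + (R + 1) * v + ((R + 1) * (v + 1) + R * (v + 1)) = 2 * (R * (2 * v + 1) + v) + 1 := by ring
  rw [h]
  exact Odd.neg_one_pow ⟨_, rfl⟩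

/-! ### transitions inside a phase `1 ≤ w ≤ n` -/

/-- `T(w,w,t) → T(w,w,t+1)`: the column `t` switches from class `2` to class `3`. -/
theorem termSign_T_step (w t : ℕ) (htw : t < w) (hwn : w ≤ n) :
    termSign (ee n) (cterm n w w t) * termSign (ee n) (cterm n w w (t + 1)) < 0 := by
  have hw1 : w ≤ n + 1 := by omega
  unfold cterm
  rw [perm_T, perm_T, termSign_mul_termSign, ShiftThree.sign_mul_self, one_mul]
  rw [Finset.prod_eq_single (⟨t, by omega⟩ : Fin (n + 1))]
  · -- the switching column
    have hr := rot_val_blk n hw1 (⟨t, by omega⟩ : Fin (n + 1)) htw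
    have hlow : ((⟨t, by omega⟩ : Fin (n + 1)) : ℕ) < ((rot n w ⟨t, by omega⟩ : Fin (n + 1)) : ℕ) := by rw [hr]; simp; omega
    rw [lam_T, lam_T, if_neg (show ¬ w ≤ t by omega), if_neg (lt_irrefl t), if_neg (show ¬ w ≤ t by omega),
      if_pos (Nat.lt_succ_self t), ee_low_two n hlow, ee_low_three n hlow]
    have hsq : ((-1 : ℤ) ^ (((rot n w ⟨t, by omega⟩ : Fin (n + 1)) : ℕ) * t) * (if t = 0 then -1 else 1)) *
        ((-1 : ℤ) ^ (((rot n w ⟨t, by omega⟩ : Fin (n + 1)) : ℕ) * t) * (if t = 0 then -1 else 1)) = 1 := by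
      rw [mul_mul_mul_comm, ← pow_add, ← two_mul, pow_mul]; split_ifs <;> simp
    nlinarith [hsq]
  · -- the other columns agree
    intro b _ hb
    have hbt : (b : ℕ) ≠ t := fun h => hb (Fin.ext h)
    have hlam : lam n w w t b = lam n w w (t + 1) b := by
      rw [lam_T, lam_T]
      by_cases h1 : w ≤ (b : ℕ)
      · rw [if_pos h1, if_pos h1]
      · rw [if_neg h1, if_neg h1]
        by_cases h2 : (b : ℕ) < t
        · rw [if_pos h2, if_pos (by omega)]
        · rw [if_neg h2, if_neg (by omega)]
    rw [← hlam]
    refine ee_mul_self n ?_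
    rw [lam_T]
    by_cases h1 : w ≤ (b : ℕ)
    · rw [if_pos h1]
      have hr := rot_val_wrap n hw1 b h1
      exact ee_upper_zero_ne n (show ((rot n w b : Fin (n + 1)) : ℕ) < (b : ℕ) by rw [hr]; omega)
    · rw [if_neg h1]
      have hr := rot_val_blk n hw1 b (by omega)
      have hlow : (b : ℕ) < ((rot n w b : Fin (n + 1)) : ℕ) := by rw [hr]; omega
      split_ifs
      · exact ee_lower_ne n hlow 3 (by decide)
      · exact ee_lower_ne n hlow 2 (by decide)
  · intro h; exact absurd (Finset.mem_univ _) h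

/-- presence of the diagonal-state incidences (columns of `D(w,u,0)`). -/
theorem present_D (w u : ℕ) (huw : u < w) (hwn : w ≤ n) (b : Fin (n + 1)) :
    ee n (rot n w b) b (lam n w u 0 b) ≠ 0 := by
  have hw1 : w ≤ n + 1 := by omega
  rw [lam_D n huw]
  by_cases h1 : w ≤ (b : ℕ)
  · rw [if_pos h1]
    have hr := rot_val_wrap n hw1 b h1
    exact ee_upper_zero_ne n (show ((rot n w b : Fin (n + 1)) : ℕ) < (b : ℕ) by rw [hr]; omega)
  · rw [if_neg h1]
    have hr := rot_val_blk n hw1 b (by omega)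
    have hlow : (b : ℕ) < ((rot n w b : Fin (n + 1)) : ℕ) := by rw [hr]; omega
    split_ifs
    · exact ee_lower_ne n hlow 2 (by decide)
    · exact ee_lower_ne n hlow 1 (by decide)

/-- `D(w,0,0) → (rot, μ)` where `μ` is class `0` on the wrap columns, class `2` at column `0` and class `1` or `2` on the other
block columns (used for `D(w,0,0) → D(w,2,0)` and `D(w,0,0) → T(w,w,0)`): only the column `0` changes its sign value. -/
theorem termSign_D_zero_step (w : ℕ) (hw0 : 1 ≤ w) (hwn : w ≤ n) (μ : Fin (n + 1) → Fin 4)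
    (hμw : ∀ b : Fin (n + 1), w ≤ (b : ℕ) → μ b = 0) (hμ0 : ∀ b : Fin (n + 1), (b : ℕ) = 0 → μ b = 2)
    (hμ12 : ∀ b : Fin (n + 1), (b : ℕ) < w → (b : ℕ) ≠ 0 → μ b = 1 ∨ μ b = 2) :
    termSign (ee n) (rot n w, lam n w 0 0) * termSign (ee n) (rot n w, μ) < 0 := by
  have hw1 : w ≤ n + 1 := by omega
  rw [termSign_mul_termSign, ShiftThree.sign_mul_self, one_mul]
  rw [Finset.prod_eq_single (⟨0, by omega⟩ : Fin (n + 1))]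
  · have hr := rot_val_blk n hw1 (⟨0, by omega⟩ : Fin (n + 1)) hw0
    have hlow : ((⟨0, by omega⟩ : Fin (n + 1)) : ℕ) < ((rot n w ⟨0, by omega⟩ : Fin (n + 1)) : ℕ) := by
      rw [hr]; simp only [Fin.val_mk]; omega
    have hμ0' : μ ⟨0, by omega⟩ = 2 := hμ0 _ rfl
    rw [lam_D n hw0, if_neg (by simp; omega), if_neg (lt_irrefl _), hμ0', ee_low_one n hlow, ee_low_two n hlow]
    simp
  · intro b _ hb
    have hb0 : (b : ℕ) ≠ 0 := fun h => hb (Fin.ext h)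
    by_cases h1 : w ≤ (b : ℕ)
    · rw [lam_D n hw0, if_pos h1, hμw b h1]
      have hr := rot_val_wrap n hw1 b h1
      exact ee_mul_self n (ee_upper_zero_ne n (show ((rot n w b : Fin (n + 1)) : ℕ) < (b : ℕ) by rw [hr]; omega))
    · have hr := rot_val_blk n hw1 b (by omega)
      have hlow : (b : ℕ) < ((rot n w b : Fin (n + 1)) : ℕ) := by rw [hr]; omega
      rw [lam_D n hw0, if_neg h1, if_neg (Nat.not_lt_zero _), ee_low_one n hlow]
      rcases hμ12 b (by omega) hb0 with h2 | h2
      · rw [h2, ee_low_one n hlow, ← pow_add, ← two_mul, pow_mul]; simp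
      · rw [h2, ee_low_two n hlow, if_neg hb0, mul_one, ← pow_add, ← two_mul, pow_mul]; simp
  · intro h; exact absurd (Finset.mem_univ _) h

/-- `D(w,0,0) → D(w,2,0)` (`w ≥ 3`). -/
theorem termSign_D_zero_two (w : ℕ) (hw3 : 3 ≤ w) (hwn : w ≤ n) :
    termSign (ee n) (cterm n w 0 0) * termSign (ee n) (cterm n w 2 0) < 0 := by
  unfold cterm
  rw [perm_D n (by omega), perm_D n (by omega)]
  refine termSign_D_zero_step n w (by omega) hwn (lam n w 2 0) ?_ ?_ ?_
  · intro b hb; rw [lam_D n (by omega), if_pos hb]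
  · intro b hb; rw [lam_D n (by omega), if_neg (by omega), if_pos (by omega)]
  · intro b hb hb0
    rw [lam_D n (by omega), if_neg (by omega)]
    split_ifs
    · exact Or.inr rfl
    · exact Or.inl rfl

/-- `D(w,0,0) → T(w,w,0)` (`w ≥ 1`; used for `w ≤ 2`). -/
theorem termSign_D_zero_T (w : ℕ) (hw0 : 1 ≤ w) (hwn : w ≤ n) :
    termSign (ee n) (cterm n w 0 0) * termSign (ee n) (cterm n w w 0) < 0 := by
  unfold cterm
  rw [perm_D n (by omega), perm_T]
  refine termSign_D_zero_step n w hw0 hwn (lam n w w 0) ?_ ?_ ?_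
  · intro b hb; rw [lam_T, if_pos hb]
  · intro b hb; rw [lam_T, if_neg (by omega), if_neg (Nat.not_lt_zero _)]
  · intro b hb hb0
    rw [lam_T, if_neg (by omega), if_neg (Nat.not_lt_zero _)]
    exact Or.inr rfl

/-- the two special rows of an excursion, as elements of `Fin m`. -/
theorem R1f_ne_R2f {w u : ℕ} (huw : u < w) (hw : w ≤ n + 1) (hu : 1 ≤ u) :
    (⟨(n + 1 - w + u - 1) % (n + 1), Nat.mod_lt _ (Nat.succ_pos n)⟩ : Fin (n + 1)) ≠
      (⟨(n + 1 - w + u) % (n + 1), Nat.mod_lt _ (Nat.succ_pos n)⟩ : Fin (n + 1)) := by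
  intro h
  have h' := congrArg Fin.val h
  dsimp only at h'
  rw [Nat.mod_eq_of_lt (by omega), Nat.mod_eq_of_lt (by omega)] at h'
  omega

/-- sign of the excursion permutation: minus the sign of the rotation. -/
theorem sign_perm_X {w u : ℕ} (huw : u < w) (hw : w ≤ n + 1) (hu : 1 ≤ u) :
    ((Equiv.Perm.sign (perm n w u 1) : ℤˣ) : ℤ) = -((Equiv.Perm.sign (rot n w) : ℤˣ) : ℤ) := by
  rw [perm_X n huw, Equiv.Perm.sign_mul, Equiv.Perm.sign_swap (R1f_ne_R2f n huw hw hu)]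
  simp

/-- the excursion permutation agrees with the rotation off the two exchanged columns. -/
theorem perm_X_eq_rot {w u : ℕ} (huw : u < w) (hw : w ≤ n) (hu : 1 ≤ u) (b : Fin (n + 1))
    (h1 : (b : ℕ) + 1 ≠ u) (h2 : (b : ℕ) ≠ u) : perm n w u 1 b = rot n w b := by
  have hw1 : w ≤ n + 1 := by omega
  apply Fin.ext
  by_cases hbw : (b : ℕ) < w
  · rw [sigmaX_blk n huw hw1 b hbw h1 h2, rot_val_blk n hw1 b hbw]
  · rw [sigmaX_wrap n huw hu hw b (by omega), rot_val_wrap n hw1 b (by omega)]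

/-- the sign bookkeeping of the two exchanged columns `u − 1`, `u` of an excursion against a plain-rotation state whose classes
there are `(2, l₂)` with `l₂ ∈ {1, 2}` (`D(w,u,0)`: `l₂ = 1`; `D(w,u+1,0)` and `T(w,w,0)`: `l₂ = 2`). -/
theorem exchange_columns (w u : ℕ) (hu2 : 2 ≤ u) (huw : u < w) (hwn : w ≤ n) (μ : Fin (n + 1) → Fin 4)
    (hμ1 : μ ⟨u - 1, by omega⟩ = 2) (hμ2 : μ ⟨u, by omega⟩ = 1 ∨ μ ⟨u, by omega⟩ = 2) :
    (ee n (rot n w ⟨u - 1, by omega⟩) ⟨u - 1, by omega⟩ (μ ⟨u - 1, by omega⟩) *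
        ee n (perm n w u 1 ⟨u - 1, by omega⟩) ⟨u - 1, by omega⟩ (lam n w u 1 ⟨u - 1, by omega⟩)) *
      (ee n (rot n w ⟨u, by omega⟩) ⟨u, by omega⟩ (μ ⟨u, by omega⟩) *
        ee n (perm n w u 1 ⟨u, by omega⟩) ⟨u, by omega⟩ (lam n w u 1 ⟨u, by omega⟩)) = 1 := by
  have hw1 : w ≤ n + 1 := by omega
  have hr1 : ((rot n w ⟨u - 1, by omega⟩ : Fin (n + 1)) : ℕ) = n + 1 - w + u - 1 := by
    rw [rot_val_blk n hw1 _ (by simp only [Fin.val_mk]; omega)]; simp only [Fin.val_mk]; omega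
  have hr2 : ((rot n w ⟨u, by omega⟩ : Fin (n + 1)) : ℕ) = n + 1 - w + u := by
    rw [rot_val_blk n hw1 _ (by simp only [Fin.val_mk]; omega)]; simp only [Fin.val_mk]; omega
  have hp1 : ((perm n w u 1 ⟨u - 1, by omega⟩ : Fin (n + 1)) : ℕ) = n + 1 - w + u :=
    sigmaX_um1 n huw hw1 _ (by simp only [Fin.val_mk]; omega)
  have hp2 : ((perm n w u 1 ⟨u, by omega⟩ : Fin (n + 1)) : ℕ) = n + 1 - w + u - 1 := sigmaX_u n huw hwn _ rfl
  have hl1 : lam n w u 1 ⟨u - 1, by omega⟩ = 3 := by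
    rw [lam_X n huw, if_neg (by simp only [Fin.val_mk]; omega), if_neg (by simp only [Fin.val_mk]; omega),
      if_pos (by simp only [Fin.val_mk]; omega)]
  have hl2 : lam n w u 1 ⟨u, by omega⟩ = 1 := by
    rw [lam_X n huw, if_neg (by simp only [Fin.val_mk]; omega), if_neg (by simp only [Fin.val_mk]; omega),
      if_neg (by simp only [Fin.val_mk]; omega)]
  have hlow1 : ((⟨u - 1, by omega⟩ : Fin (n + 1)) : ℕ) < ((rot n w ⟨u - 1, by omega⟩ : Fin (n + 1)) : ℕ) := by
    rw [hr1]; simp only [Fin.val_mk]; omega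
  have hlow1' : ((⟨u - 1, by omega⟩ : Fin (n + 1)) : ℕ) < ((perm n w u 1 ⟨u - 1, by omega⟩ : Fin (n + 1)) : ℕ) := by
    rw [hp1]; simp only [Fin.val_mk]; omega
  have hlow2 : ((⟨u, by omega⟩ : Fin (n + 1)) : ℕ) < ((rot n w ⟨u, by omega⟩ : Fin (n + 1)) : ℕ) := by
    rw [hr2]; simp only [Fin.val_mk]; omega
  -- the lifted cell `(R₁, u)` is a lower cell for `w < n` and the diagonal cell for `w = n`; its sign is `(−1)^{R₁ u}` either way
  have hXu : ee n (perm n w u 1 ⟨u, by omega⟩) ⟨u, by omega⟩ 1 = (-1) ^ ((n + 1 - w + u - 1) * u) := by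
    rcases Nat.lt_or_ge w n with hwn' | hwn'
    · have hlow2' : ((⟨u, by omega⟩ : Fin (n + 1)) : ℕ) < ((perm n w u 1 ⟨u, by omega⟩ : Fin (n + 1)) : ℕ) := by
        rw [hp2]; simp only [Fin.val_mk]; omega
      rw [ee_low_one n hlow2', hp2]
    · have hdg : ((perm n w u 1 ⟨u, by omega⟩ : Fin (n + 1)) : ℕ) = ((⟨u, by omega⟩ : Fin (n + 1)) : ℕ) := by
        rw [hp2]; simp only [Fin.val_mk]; omega
      rw [ee_diag_one n hdg, show n + 1 - w + u - 1 = u by omega, neg_one_pow_mul_self']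
  have key := exchange_parity (n + 1 - w + u - 1) u (by omega)
  rw [show n + 1 - w + u - 1 + 1 = n + 1 - w + u by omega] at key
  rw [hμ1, hl1, hl2, ee_low_two n hlow1, ee_low_three n hlow1', hXu, hr1, hp1]
  simp only [Fin.val_mk]
  rw [if_neg (show u - 1 ≠ 0 by omega)]
  rcases hμ2 with h2 | h2
  · rw [h2, ee_low_one n hlow2, hr2]
    simp only [Fin.val_mk]
    linear_combination (-1 : ℤ) * key
  · rw [h2, ee_low_two n hlow2, hr2]
    simp only [Fin.val_mk]
    rw [if_neg (show u ≠ 0 by omega)]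
    linear_combination (-1 : ℤ) * key

/-- off the two exchanged columns the excursion agrees with the diagonal state `D(w,u,0)`. -/
theorem lam_X_eq_lam_D {w u : ℕ} (huw : u < w) (b : Fin (n + 1)) (h1 : (b : ℕ) + 1 ≠ u) (h2 : (b : ℕ) ≠ u) :
    lam n w u 1 b = lam n w u 0 b := by
  rw [lam_D n huw, lam_X n huw]
  by_cases h3 : w ≤ (b : ℕ)
  · rw [if_pos h3, if_pos h3]
  · rw [if_neg h3, if_neg h3]
    by_cases h4 : (b : ℕ) + 1 < u
    · rw [if_pos h4, if_pos (by omega)]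
    · rw [if_neg h4, if_neg (by omega), if_neg (by omega)]

/-- `D(w,u,0) → X(w,u,1)` (`2 ≤ u < w ≤ n`): rows of the columns `u − 1`, `u` exchanged. -/
theorem termSign_D_X (w u : ℕ) (hu2 : 2 ≤ u) (huw : u < w) (hwn : w ≤ n) :
    termSign (ee n) (cterm n w u 0) * termSign (ee n) (cterm n w u 1) < 0 := by
  have hw1 : w ≤ n + 1 := by omega
  unfold cterm
  rw [perm_D n (Nat.ne_of_lt huw), termSign_mul_termSign, sign_perm_X n huw hw1 (by omega), mul_neg, ShiftThree.sign_mul_self]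
  have hc12 : (⟨u - 1, by omega⟩ : Fin (n + 1)) ≠ ⟨u, by omega⟩ := by
    intro h; have := congrArg Fin.val h; simp only [Fin.val_mk] at this; omega
  rw [Finset.prod_eq_mul _ _ hc12]
  · have hl1 : lam n w u 0 ⟨u - 1, by omega⟩ = 2 := by
      rw [lam_D n huw, if_neg (by simp only [Fin.val_mk]; omega), if_pos (by simp only [Fin.val_mk]; omega)]
    have hl2 : lam n w u 0 ⟨u, by omega⟩ = 1 := by
      rw [lam_D n huw, if_neg (by simp only [Fin.val_mk]; omega), if_neg (by simp only [Fin.val_mk]; omega)]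
    have h := exchange_columns n w u hu2 huw hwn (lam n w u 0) hl1 (Or.inl hl2)
    rw [h]; norm_num
  · intro b _ hb
    obtain ⟨hb1, hb2⟩ := hb
    have hb1' : (b : ℕ) + 1 ≠ u := fun h => hb1 (Fin.ext (by simp only [Fin.val_mk]; omega))
    have hb2' : (b : ℕ) ≠ u := fun h => hb2 (Fin.ext (by simp only [Fin.val_mk]; omega))
    rw [perm_X_eq_rot n huw hwn (by omega) b hb1' hb2', lam_X_eq_lam_D n huw b hb1' hb2']
    exact ee_mul_self n (present_D n w u huw hwn b)
  · intro h; exact absurd (Finset.mem_univ _) h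
  · intro h; exact absurd (Finset.mem_univ _) h

/-- `X(w,u,1) → D(w,u+1,0)` (`2 ≤ u`, `u + 1 < w ≤ n`): rows of the columns `u − 1`, `u` exchanged back, column `u` now class `2`. -/
theorem termSign_X_D (w u : ℕ) (hu2 : 2 ≤ u) (huw : u + 1 < w) (hwn : w ≤ n) :
    termSign (ee n) (cterm n w u 1) * termSign (ee n) (cterm n w (u + 1) 0) < 0 := by
  have hw1 : w ≤ n + 1 := by omega
  have huw' : u < w := by omega
  rw [mul_comm]
  unfold cterm
  rw [perm_D n (show u + 1 ≠ w by omega), termSign_mul_termSign, sign_perm_X n huw' hw1 (by omega), mul_neg, ShiftThree.sign_mul_self]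
  have hc12 : (⟨u - 1, by omega⟩ : Fin (n + 1)) ≠ ⟨u, by omega⟩ := by
    intro h; have := congrArg Fin.val h; simp only [Fin.val_mk] at this; omega
  rw [Finset.prod_eq_mul _ _ hc12]
  · have hl1 : lam n w (u + 1) 0 ⟨u - 1, by omega⟩ = 2 := by
      rw [lam_D n huw, if_neg (by simp only [Fin.val_mk]; omega), if_pos (by simp only [Fin.val_mk]; omega)]
    have hl2 : lam n w (u + 1) 0 ⟨u, by omega⟩ = 2 := by
      rw [lam_D n huw, if_neg (by simp only [Fin.val_mk]; omega), if_pos (by simp only [Fin.val_mk]; omega)]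
    have h := exchange_columns n w u hu2 huw' hwn (lam n w (u + 1) 0) hl1 (Or.inr hl2)
    rw [h]; norm_num
  · intro b _ hb
    obtain ⟨hb1, hb2⟩ := hb
    have hb1' : (b : ℕ) + 1 ≠ u := fun h => hb1 (Fin.ext (by simp only [Fin.val_mk]; omega))
    have hb2' : (b : ℕ) ≠ u := fun h => hb2 (Fin.ext (by simp only [Fin.val_mk]; omega))
    have hlam : lam n w u 1 b = lam n w (u + 1) 0 b := by
      rw [lam_X_eq_lam_D n huw' b hb1' hb2', lam_D n huw', lam_D n huw]
      by_cases h3 : w ≤ (b : ℕ)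
      · rw [if_pos h3, if_pos h3]
      · rw [if_neg h3, if_neg h3]
        by_cases h4 : (b : ℕ) < u
        · rw [if_pos h4, if_pos (by omega)]
        · rw [if_neg h4, if_neg (by omega)]
    rw [perm_X_eq_rot n huw' hwn (by omega) b hb1' hb2', hlam]
    exact ee_mul_self n (present_D n w (u + 1) huw hwn b)
  · intro h; exact absurd (Finset.mem_univ _) h
  · intro h; exact absurd (Finset.mem_univ _) h

end GradedWalk

end Summit.ValiantsHypothesis.ValiantsHypothesis.Theorems.LacunarySymmetroidMatrixDescartes.TropicalCensus
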